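import Literature.MathematicalPhysics.QuantumFieldTheory.BalabanImbrieJaffe1984to88.BIJ85Sect4Statements
import Mathlib.Analysis.SpecificLimits.Normed

/-!
# `BalabanImbrieJaffe1984to88.BIJ88Resolvent5711` — T. Bałaban, J. Imbrie, A. Jaffe, *Effective action and cluster properties of
the abelian Higgs model*, Commun. Math. Phys. **114** (1988) 257–315 [BalabanImbrieJaffe1988]: the operator identities around
**(5.7.11)** p. 293 [PDF 37] PROVED as ring algebra — *"We insert this expansion into C^{(j)−1} to obtain
C^{(j)}_{B_{m−j}(Λ₃^{(m)})}(u_{k+1})^{−1} = C^{(j)}_{B_{m−j}(Λ₃^{(m)})}(Λ̄₂^{(m)},u_{k+1})^{−1} + Σ_X Δ_j(X), where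
C^{(j)}_{B_{m−j}(Λ₃^{(m)})}(Λ̄₂^{(m)},u_{k+1})^{−1} = a_jI − a_j²Q_j(u_{k+1})G_j(Λ̄₂^{(m)},u_{k+1})Q_j^*(u_{k+1}) + aL^{−2}P(u_{k+1}), (5.7.11) …
Thus we have C(u_{k+1}) = C(Λ̄₂,u_{k+1}) − C(Λ̄₂,u_{k+1})(Σ_X Δ_j(X))C(u_{k+1}). … Also, we expand any C(Λ̄₂,u_{k+1}) as
Σ_{p=0}^∞ C(u_{k+1})[Σ_X Δ_j(X)C(u_{k+1})]^p"*.

statement-level skeleton of published theorems with citation tags; proofs where landed; nothing here is a claim about the Yang–Mills mass gap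

PDF held: `paper:balaban1988-cmp114-bij-abelian-higgs-effective-action` (journal page = PDF page + 256).  Page read as image: PDF p. 37
(journal 293), `g4png.py` ×2 render (seat folder `renders/original-p037-x2.png`).

CITATION HEADER (lean-in-tree rule).  Part of the lit-balaban TYPED SKELETON (HOME `run/shared/lean/pub/lit-balaban/`), Phase 2,
seat p36 (gen 4, unit `lit-balaban-p36`); row **C2.Eq5.7.10-5.7.12** of `HOME/lit-balaban-r16/ROWS-C2-part2.md` (r16: *"(5.7.11)–(5.7.12)
bounds absent"*; the resummation telescoping behind (5.7.10) is r16's `BIJ88Sect5StatementsPart4.telescope5710`).  WHAT IS REPRODUCED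
(theorem-only; the style of r16's (5.6.11) `BIJ88Sect5Statements.eq5611`): in a ring of operators,
* the inverse covariance (5.7.11) IS [2]'s (4.6.4) `BIJ85Sect4Statements.deltaScalar a_j Q G Q*` plus `aL^{−2}P`; it is AFFINE in the
  propagator `G`, so inserting the expansion `G_{j,loc} = G_j(Λ̄₂) + Σ_X G_j(Λ̄₂,X)` (display before (5.7.11)) gives
  `C^{−1} = C̄^{−1} + Σ_X Δ_j(X)` with `Δ_j(X) = −a_j² Q G_j(Λ̄₂,X) Q*` (`inv5711_sub`, `inv5711_expand`);
* *"Thus we have C = C̄ − C̄(Σ_X Δ_j(X))C"* from `C^{−1} = C̄^{−1} + D` (`resolvent5711`: `a c = 1`, `c̄ ā = 1`, `a = ā + D ⟹ c = c̄ − c̄ D c`);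
* *"we expand any C̄ as Σ_{p=0}^∞ C [Σ_X Δ_j(X) C]^p"* in a complete normed ring when `‖D C‖ < 1` (`neumann5711`, Mathlib's geometric
  series `mul_neg_geom_series`).
NOT here: the bounds `|Δ_j(X,x₁,x₂)| ≤ e^{−cr(e_j)|X|}`, the support clause, the random-walk expansions themselves, (5.7.12); no new
definitions, no `Prop` facts; axioms standard.
-/

namespace Literature.MathematicalPhysics.QuantumFieldTheory.BalabanImbrieJaffe1984to88.BIJ88Resolvent5711

open BIJ85Sect4Statements (deltaScalar)

/-! ## §1 (5.7.11) is affine in the propagator: `C^{−1} = C̄^{−1} + Σ_X Δ_j(X)` -/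

section Affine

variable {R : Type*} [Ring R] [Algebra ℝ R]

/-- (5.7.11) is AFFINE in `G`: `(a·1 − a²QG₁Q* + P′) − (a·1 − a²QG₂Q* + P′) = −a²·Q(G₁ − G₂)Q*` (`P′ = aL^{−2}P`).
[cite: BalabanImbrieJaffe1988, (5.7.11) p.293] -/
theorem inv5711_sub (a : ℝ) (Q G₁ G₂ Qs P' : R) :
    (deltaScalar a Q G₁ Qs + P') - (deltaScalar a Q G₂ Qs + P') = -(algebraMap ℝ R (a ^ 2) * (Q * (G₁ - G₂) * Qs)) := by
  simp only [deltaScalar]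
  noncomm_ring

/-- **`C^{−1} = C̄^{−1} + Σ_X Δ_j(X)`** p. 293: inserting an expansion `G_loc = Ḡ + Σ_X G_X` of the propagator into (5.7.11) gives the
inverse covariance with `Ḡ` plus the pieces `Δ_j(X) = −a_j²·Q G_X Q*`. [cite: BalabanImbrieJaffe1988, (5.7.11) p.293] -/
theorem inv5711_expand {ξ : Type*} (S : Finset ξ) (a : ℝ) (Q Qs P' Gloc Gbar : R) (GX : ξ → R)
    (hexp : Gloc = Gbar + ∑ X ∈ S, GX X) :
    deltaScalar a Q Gloc Qs + P' =
      (deltaScalar a Q Gbar Qs + P') + ∑ X ∈ S, -(algebraMap ℝ R (a ^ 2) * (Q * GX X * Qs)) := by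
  rw [hexp]
  have h := inv5711_sub a Q (Gbar + ∑ X ∈ S, GX X) Gbar Qs P'
  rw [add_sub_cancel_left, Finset.mul_sum, Finset.sum_mul, Finset.mul_sum, ← Finset.sum_neg_distrib] at h
  rw [← h]
  abel

end Affine

/-! ## §2 *"Thus we have C = C̄ − C̄(Σ_X Δ_j(X))C"* and the expansion *"Σ_{p=0}^∞ C[Σ_X Δ_j(X) C]^p"* -/

section Resolvent

/-- **The second resolvent identity behind p. 293**: if `a c = 1` (`c = C`, `a = C^{−1}`), `c̄ ā = 1` (`c̄ = C̄`, `ā = C̄^{−1}`) and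
`a = ā + D` (`D = Σ_X Δ_j(X)`), then *"C = C̄ − C̄(Σ_X Δ_j(X))C"*: `c = c̄ − c̄ D c`. [cite: BalabanImbrieJaffe1988, (5.7.11) p.293] -/
theorem resolvent5711 {R : Type*} [Ring R] {a abar c cbar D : R} (hc : a * c = 1) (hcbar : cbar * abar = 1)
    (hD : a = abar + D) : c = cbar - cbar * D * c := by
  have hD' : D = a - abar := by rw [hD]; abel
  have key : cbar * D * c = cbar - c := by
    rw [hD', mul_sub, sub_mul, mul_assoc, hc, mul_one, hcbar, one_mul]
  rw [key]
  abel

/-- **The expansion *"Σ_{p=0}^∞ C[Σ_X Δ_j(X) C]^p"* of `C̄`** p. 293: in a complete normed ring, `c = c̄ − c̄ D c` and `‖D c‖ < 1` give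
`c̄ = Σ_{p≥0} c (D c)^p` (norm-convergent geometric series). [cite: BalabanImbrieJaffe1988, (5.7.11) p.293] -/
theorem neumann5711 {R : Type*} [NormedRing R] [CompleteSpace R] {c cbar D : R} (h : c = cbar - cbar * D * c)
    (hn : ‖D * c‖ < 1) : cbar = ∑' p : ℕ, c * (D * c) ^ p := by
  have h1 : cbar * (1 - D * c) = c := by
    rw [mul_sub, mul_one, ← mul_assoc]
    exact h.symm
  have hgeom : (1 - D * c) * ∑' p : ℕ, (D * c) ^ p = 1 := mul_neg_geom_series (D * c) hn
  have hsum : Summable fun p : ℕ => (D * c) ^ p := summable_geometric_of_norm_lt_one hn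
  calc cbar = cbar * ((1 - D * c) * ∑' p : ℕ, (D * c) ^ p) := by rw [hgeom, mul_one]
    _ = c * ∑' p : ℕ, (D * c) ^ p := by rw [← mul_assoc, h1]
    _ = ∑' p : ℕ, c * (D * c) ^ p := hsum.tsum_mul_left c |>.symm

/-- the two displays combined: from `C^{−1} = C̄^{−1} + D`, `‖D C‖ < 1`: `C̄ = Σ_{p≥0} C (D C)^p`.
[cite: BalabanImbrieJaffe1988, (5.7.11) p.293] -/
theorem neumann5711_of_inv_add {R : Type*} [NormedRing R] [CompleteSpace R] {a abar c cbar D : R} (hc : a * c = 1)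
    (hcbar : cbar * abar = 1) (hD : a = abar + D) (hn : ‖D * c‖ < 1) : cbar = ∑' p : ℕ, c * (D * c) ^ p :=
  neumann5711 (resolvent5711 hc hcbar hD) hn

end Resolvent

end Literature.MathematicalPhysics.QuantumFieldTheory.BalabanImbrieJaffe1984to88.BIJ88Resolvent5711
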